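import Summits.BirchSwinnertonDyer.BirchSwinnertonDyer.Theses.ShaPrimaryTransfer
import Literature.NumberTheory.EllipticCurves.KubertTateM85ShaSeven
import Literature.NumberTheory.EllipticCurves.KubertTateM81ShaSeven
import Literature.NumberTheory.EllipticCurves.KubertTateM115ShaSeven
import Summits.BirchSwinnertonDyer.BirchSwinnertonDyer.Theorems.ShaPrimaryTransferFiniteShaComponentTransferOddDoor
import HarnessLib

/-!
# The door at `7` on the Kubert–Tate `X₁(7)`-family: `t₇ = 0` by descent alone, `T` by name at `p₀ = 7`

Helper for item **stmt-BirchSwinnertonDyer-22356** (`FiniteShaComponentTransfer`, «T», the transfer slice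
of route `ShaPrimaryTransfer`); it closes nothing by itself — `T` is conjecture-grade at analytic rank
`≥ 2` and **BSD is NOT proved by this file**. It completes the set of torsion primes `{2, 3, 5, 7}` (Mazur)
at which the route's door `O` is opened by a rational-isogeny descent: after the doors at `2`
(`…DoorAtTwo`), `3` (`…DoorAtThree*`) and `5` (`…DoorAtFive*`), the GENERIC `μ₇`-descent engine
(`Literature.….KubertTateSevenMuDescent`, files `KubertTateSevenMuDescent[Box]`, sibling of the `μ₅` engine)
on the universal `7`-torsion curve `E_{m,n} = kubertTateSeven m n = [n² + mn − m², m²n(n−m), m²n³(n−m), 0, 0]`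
gives:

* §0 CLASS-WIDE on the tame family (`7 ∤ Δ`, no bad prime `≡ 1 (mod 7)`, a good prime `q ≤ 23`, `q ≠ 7`, one
  rational point `P₁` with `49 P₁ ≠ O`): **`rank E_{m,n}(ℚ) + t₇(E_{m,n}) + 1 ≤ ω(mn(m−n))`** — the engine's
  first-descent bound `#Ш[7] · 7^{rank+1} ≤ 7^{ω}` (`KubertTateSevenMuDescent.natCard_sha_torsionBy_seven_mul_pow_le`)
  read through `#Ш[7] = 7^{t₇ + 2m}` (Cassels–Tate, a tree theorem:
  `ShaPrimaryTransferOddDoor.exists_natCard_sha_torsionBy_eq_pow`); hence `t₇ = 0` whenever the rank attains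
  `ω − 1` (`shaCorank_seven_eq_zero_of_rank`).
* `E₂ = E_{−8/5} = [−79, 4160, 104000, 0, 0]` (`kubertTateSeven (−8) 5`; **rank `2`**; `S = {2, 5, 13}`):
  `shaCorank_seven_E₂ : t₇(E₂) = 0`, `mordellWeilRank_E₂ : rank = 2`, `selmerCorank_seven_E₂ : s₇(E₂) = 2`,
  **`transfer_at_seven_E₂ : FiniteShaComponentTransfer → ∀ q, t_q(E₂) = 0`** (`T` BY NAME at the witness
  prime `p₀ = 7`), `oneFiniteShaComponent_E₂` (the route's `O`, unconditional, witness `7`) — the first curve in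
  the tree with an unconditional `t₇ = 0` at rank `≥ 2`.
* `E₁ = E_{−8} = [−71, 576, 576, 0, 0]` (`kubertTateSeven (−8) 1`; rank `1`; `S = {2, 3}`): the same five
  statements (`…_E₁`).
* `E₂' = E_{−11/5} = [−151, 9680, 242000, 0, 0]` (`kubertTateSeven (−11) 5`; **rank `2`**; `S = {2, 5, 11}`):
  `shaCorank_seven_E₂'`, `mordellWeilRank_E₂'`, `transfer_at_seven_E₂'`, `oneFiniteShaComponent_E₂'` — a second
  rank-`2` instance (the engine is not a one-off).

All statements are unconditional except those taking `hT : FiniteShaComponentTransfer`.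

## References

* [SilvermanAEC2009] J. H. Silverman, *AEC*, 2nd ed., Thm. X.4.2, Exercise 10.1.
* [Fisher2001FiveSevenDescent] T. Fisher, JEMS 3 (2001), §§1–2.
-/

noncomputable section

set_option linter.dupNamespace false

open WeierstrassCurve
open Literature.NumberTheory.EllipticCurves
open Summit.BirchSwinnertonDyer.BirchSwinnertonDyer.Theses.ShaPrimaryTransfer

namespace Summit.BirchSwinnertonDyer.BirchSwinnertonDyer.Theorems.ShaPrimaryTransferDoorAtSeven

/-! ## §0 Class-wide: `rank + t₇ + 1 ≤ ω(mn(m−n))` on the tame Kubert–Tate `7`-torsion family -/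

/-- **Class-wide Selmer-corank bound on the tame Kubert–Tate `7`-torsion family**: for `E_{m,n}` elliptic with
`7 ∤ Δ`, no bad prime `≡ 1 (mod 7)`, a good prime `q ≤ 23`, `q ≠ 7`, and a rational point `P₁` with `49 P₁ ≠ O`,
**`rank E_{m,n}(ℚ) + t₇(E_{m,n}) + 1 ≤ ω(mn(m−n))`** — unconditionally (first `7`-descent + Cassels–Tate, both tree
theorems). [cite: SilvermanAEC2009, Thm. X.4.2 and Prop. X.4.9] [cite: Fisher2001FiveSevenDescent, §2] -/
theorem rank_add_shaCorank_seven_succ_le (m n : ℤ) [(kubertTateSeven (m : ℚ) (n : ℚ)).IsElliptic]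
    (P₁ : geomPoints (kubertTateSeven (m : ℚ) (n : ℚ)))
    (hP₁ : ∀ σ : Field.absoluteGaloisGroup ℚ, σ • P₁ = P₁) (h49 : ((49 : ℕ) : ℤ) • P₁ ≠ 0)
    (h7 : ¬ (7 : ℤ) ∣ (kubertTateSeven m n).Δ)
    (h1 : ∀ p : ℕ, p.Prime → (p : ℤ) ∣ (kubertTateSeven m n).Δ → p % 7 ≠ 1)
    (q : ℕ) [Fact q.Prime] (hq7 : q ≠ 7) (hq23 : 2 * q + 1 < 49) (hq : ¬ (q : ℤ) ∣ (kubertTateSeven m n).Δ) :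
    (kubertTateSeven (m : ℚ) (n : ℚ)).mordellWeilRank + (kubertTateSeven (m : ℚ) (n : ℚ)).shaCorank 7 + 1 ≤
      (m * n * (m - n)).natAbs.primeFactors.card := by
  have h7tors := KubertTateSevenTorsion.natCard_torsionBy_seven m n q hq7 hq23 hq
  have hb := KubertTateSevenMuDescent.natCard_sha_torsionBy_seven_mul_pow_le m n P₁ hP₁ h49 h7 h1 h7tors
  obtain ⟨k, hk⟩ :=
    ShaPrimaryTransferOddDoor.exists_natCard_sha_torsionBy_eq_pow (kubertTateSeven (m : ℚ) (n : ℚ)) 7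
  rw [hk, ← pow_add] at hb
  have := (Nat.pow_le_pow_iff_right (by norm_num : 1 < 7)).mp hb
  omega

/-- **… hence `t₇(E_{m,n}) = 0` whenever the rank attains the descent bound `ω(mn(m−n)) − 1`** (class-wide,
same hypotheses). [cite: SilvermanAEC2009, Thm. X.4.2] [cite: Fisher2001FiveSevenDescent, §2] -/
theorem shaCorank_seven_eq_zero_of_rank (m n : ℤ) [(kubertTateSeven (m : ℚ) (n : ℚ)).IsElliptic]
    (P₁ : geomPoints (kubertTateSeven (m : ℚ) (n : ℚ)))
    (hP₁ : ∀ σ : Field.absoluteGaloisGroup ℚ, σ • P₁ = P₁) (h49 : ((49 : ℕ) : ℤ) • P₁ ≠ 0)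
    (h7 : ¬ (7 : ℤ) ∣ (kubertTateSeven m n).Δ)
    (h1 : ∀ p : ℕ, p.Prime → (p : ℤ) ∣ (kubertTateSeven m n).Δ → p % 7 ≠ 1)
    (q : ℕ) [Fact q.Prime] (hq7 : q ≠ 7) (hq23 : 2 * q + 1 < 49) (hq : ¬ (q : ℤ) ∣ (kubertTateSeven m n).Δ)
    (hr : (m * n * (m - n)).natAbs.primeFactors.card ≤ (kubertTateSeven (m : ℚ) (n : ℚ)).mordellWeilRank + 1) :
    (kubertTateSeven (m : ℚ) (n : ℚ)).shaCorank 7 = 0 := by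
  have h := rank_add_shaCorank_seven_succ_le m n P₁ hP₁ h49 h7 h1 q hq7 hq23 hq
  omega

/-! ## §1 `E₂ = E_{−8/5}` (rank `2`) -/

/-- **`t₇(E_{−8/5}) = 0`, unconditionally** (generic `μ₇`-descent, three points, rank `2`).
[cite: SilvermanAEC2009, Thm. X.4.2(a)] -/
theorem shaCorank_seven_E₂ :
    haveI := KubertTateM85Descent.isElliptic
    (kubertTateSeven (((-8 : ℤ) : ℚ)) (((5 : ℤ) : ℚ))).shaCorank 7 = 0 :=
  KubertTateM85Descent.shaCorank_seven_eq_zero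

/-- **`rank E_{−8/5}(ℚ) = 2`, unconditionally.** [cite: SilvermanAEC2009, Thm. X.4.2 and Thm. X.1.1] -/
theorem mordellWeilRank_E₂ :
    haveI := KubertTateM85Descent.isElliptic
    (kubertTateSeven (((-8 : ℤ) : ℚ)) (((5 : ℤ) : ℚ))).mordellWeilRank = 2 :=
  KubertTateM85Descent.mordellWeilRank_eq

/-- **`s₇(E_{−8/5}) = corank_{ℤ₇} Sel_{7^∞} = 2 = rank`** (`s_p = r + t_p`, tree
`selmerCorank_eq_mordellWeilRank_add_holds`). [cite: SilvermanAEC2009, Thm. X.4.2(b)] -/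
theorem selmerCorank_seven_E₂ :
    haveI := KubertTateM85Descent.isElliptic
    (kubertTateSeven (((-8 : ℤ) : ℚ)) (((5 : ℤ) : ℚ))).selmerCorank 7 = 2 := by
  haveI := KubertTateM85Descent.isElliptic
  haveI : Fact (Nat.Prime 7) := ⟨by norm_num⟩
  rw [(kubertTateSeven (((-8 : ℤ) : ℚ)) (((5 : ℤ) : ℚ))).selmerCorank_eq_mordellWeilRank_add_holds 7,
    shaCorank_seven_E₂, mordellWeilRank_E₂]

/-- **`T` BY NAME at the witness prime `p₀ = 7` on `E_{−8/5}`**: granting `FiniteShaComponentTransfer`,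
`t_q(E_{−8/5}) = 0` for EVERY prime `q`. [cite: SilvermanAEC2009, Thm. X.4.2(a)] -/
theorem transfer_at_seven_E₂ (hT : FiniteShaComponentTransfer) (q : ℕ) [Fact q.Prime] :
    haveI := KubertTateM85Descent.isElliptic
    (kubertTateSeven (((-8 : ℤ) : ℚ)) (((5 : ℤ) : ℚ))).shaCorank q = 0 :=
  haveI := KubertTateM85Descent.isElliptic
  haveI : Fact (Nat.Prime 7) := ⟨by norm_num⟩
  hT _ 7 q shaCorank_seven_E₂

/-- Under `T`: every `s_q(E_{−8/5}) = 2 = rank`. [cite: SilvermanAEC2009, Thm. X.4.2(b)] -/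
theorem selmerCorank_E₂_of_transfer (hT : FiniteShaComponentTransfer) (q : ℕ) [Fact q.Prime] :
    haveI := KubertTateM85Descent.isElliptic
    (kubertTateSeven (((-8 : ℤ) : ℚ)) (((5 : ℤ) : ℚ))).selmerCorank q = 2 := by
  haveI := KubertTateM85Descent.isElliptic
  rw [(kubertTateSeven (((-8 : ℤ) : ℚ)) (((5 : ℤ) : ℚ))).selmerCorank_eq_mordellWeilRank_add_holds q,
    transfer_at_seven_E₂ hT q, mordellWeilRank_E₂]

/-- **The route's `O = OneFiniteShaComponent` holds for `E_{−8/5}`, witness `p₀ = 7`, unconditionally.**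
[cite: SilvermanAEC2009, Thm. X.4.2(a)] -/
theorem oneFiniteShaComponent_E₂ :
    haveI := KubertTateM85Descent.isElliptic
    ∃ (p : ℕ) (_ : Fact p.Prime), (kubertTateSeven (((-8 : ℤ) : ℚ)) (((5 : ℤ) : ℚ))).shaCorank p = 0 :=
  ⟨7, ⟨by norm_num⟩, shaCorank_seven_E₂⟩

/-! ## §2 `E₁ = E_{−8}` (rank `1`) -/

/-- **`t₇(E_{−8}) = 0`, unconditionally** (generic `μ₇`-descent, the point `(-16, 80)` and `3T`).
[cite: SilvermanAEC2009, Thm. X.4.2(a)] -/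
theorem shaCorank_seven_E₁ :
    haveI := KubertTateM81Descent.isElliptic
    (kubertTateSeven (((-8 : ℤ) : ℚ)) (((1 : ℤ) : ℚ))).shaCorank 7 = 0 :=
  KubertTateM81Descent.shaCorank_seven_eq_zero

/-- **`rank E_{−8}(ℚ) = 1`, unconditionally.** [cite: SilvermanAEC2009, Thm. X.4.2 and Thm. X.1.1] -/
theorem mordellWeilRank_E₁ :
    haveI := KubertTateM81Descent.isElliptic
    (kubertTateSeven (((-8 : ℤ) : ℚ)) (((1 : ℤ) : ℚ))).mordellWeilRank = 1 :=
  KubertTateM81Descent.mordellWeilRank_eq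

/-- **`s₇(E_{−8}) = 1 = rank`.** [cite: SilvermanAEC2009, Thm. X.4.2(b)] -/
theorem selmerCorank_seven_E₁ :
    haveI := KubertTateM81Descent.isElliptic
    (kubertTateSeven (((-8 : ℤ) : ℚ)) (((1 : ℤ) : ℚ))).selmerCorank 7 = 1 := by
  haveI := KubertTateM81Descent.isElliptic
  haveI : Fact (Nat.Prime 7) := ⟨by norm_num⟩
  rw [(kubertTateSeven (((-8 : ℤ) : ℚ)) (((1 : ℤ) : ℚ))).selmerCorank_eq_mordellWeilRank_add_holds 7,
    shaCorank_seven_E₁, mordellWeilRank_E₁]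

/-- **`T` BY NAME at the witness prime `p₀ = 7` on `E_{−8}`**: granting `FiniteShaComponentTransfer`,
`t_q(E_{−8}) = 0` for every prime `q`. [cite: SilvermanAEC2009, Thm. X.4.2(a)] -/
theorem transfer_at_seven_E₁ (hT : FiniteShaComponentTransfer) (q : ℕ) [Fact q.Prime] :
    haveI := KubertTateM81Descent.isElliptic
    (kubertTateSeven (((-8 : ℤ) : ℚ)) (((1 : ℤ) : ℚ))).shaCorank q = 0 :=
  haveI := KubertTateM81Descent.isElliptic
  haveI : Fact (Nat.Prime 7) := ⟨by norm_num⟩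
  hT _ 7 q shaCorank_seven_E₁

/-- **The route's `O = OneFiniteShaComponent` holds for `E_{−8}`, witness `p₀ = 7`, unconditionally.**
[cite: SilvermanAEC2009, Thm. X.4.2(a)] -/
theorem oneFiniteShaComponent_E₁ :
    haveI := KubertTateM81Descent.isElliptic
    ∃ (p : ℕ) (_ : Fact p.Prime), (kubertTateSeven (((-8 : ℤ) : ℚ)) (((1 : ℤ) : ℚ))).shaCorank p = 0 :=
  ⟨7, ⟨by norm_num⟩, shaCorank_seven_E₁⟩

/-! ## §3 `E₂' = E_{−11/5}` (rank `2`) -/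

/-- **`t₇(E_{−11/5}) = 0`, unconditionally** (generic `μ₇`-descent, three points, rank `2`).
[cite: SilvermanAEC2009, Thm. X.4.2(a)] -/
theorem shaCorank_seven_E₂' :
    haveI := KubertTateM115Descent.isElliptic
    (kubertTateSeven (((-11 : ℤ) : ℚ)) (((5 : ℤ) : ℚ))).shaCorank 7 = 0 :=
  KubertTateM115Descent.shaCorank_seven_eq_zero

/-- **`rank E_{−11/5}(ℚ) = 2`, unconditionally.** [cite: SilvermanAEC2009, Thm. X.4.2 and Thm. X.1.1] -/
theorem mordellWeilRank_E₂' :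
    haveI := KubertTateM115Descent.isElliptic
    (kubertTateSeven (((-11 : ℤ) : ℚ)) (((5 : ℤ) : ℚ))).mordellWeilRank = 2 :=
  KubertTateM115Descent.mordellWeilRank_eq

/-- **`T` BY NAME at the witness prime `p₀ = 7` on `E_{−11/5}`**: granting `FiniteShaComponentTransfer`,
`t_q(E_{−11/5}) = 0` for every prime `q`. [cite: SilvermanAEC2009, Thm. X.4.2(a)] -/
theorem transfer_at_seven_E₂' (hT : FiniteShaComponentTransfer) (q : ℕ) [Fact q.Prime] :
    haveI := KubertTateM115Descent.isElliptic
    (kubertTateSeven (((-11 : ℤ) : ℚ)) (((5 : ℤ) : ℚ))).shaCorank q = 0 :=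
  haveI := KubertTateM115Descent.isElliptic
  haveI : Fact (Nat.Prime 7) := ⟨by norm_num⟩
  hT _ 7 q shaCorank_seven_E₂'

/-- **The route's `O = OneFiniteShaComponent` holds for `E_{−11/5}`, witness `p₀ = 7`, unconditionally.**
[cite: SilvermanAEC2009, Thm. X.4.2(a)] -/
theorem oneFiniteShaComponent_E₂' :
    haveI := KubertTateM115Descent.isElliptic
    ∃ (p : ℕ) (_ : Fact p.Prime), (kubertTateSeven (((-11 : ℤ) : ℚ)) (((5 : ℤ) : ℚ))).shaCorank p = 0 :=
  ⟨7, ⟨by norm_num⟩, shaCorank_seven_E₂'⟩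

end Summit.BirchSwinnertonDyer.BirchSwinnertonDyer.Theorems.ShaPrimaryTransferDoorAtSeven

end
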